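import Summits.BirchSwinnertonDyer.Rank1Residual.Additive.SignedSelmerLevelBridge
import HarnessLib

/-!
# The bridge `[A₀ : S₀] = [H¹_{𝓣[v₀ ↦ 𝓣_{v₀} ⊓ G]} : H¹_{𝓚[v₀ ↦ 0]}]` with an ARBITRARY local
# receptacle `G` at `v₀` — the shape the re-assembly of the count (C) needs (cell `b2b-bsdres`,
# CLASS-CLOSURE lane, class O10 — x1b GEN 39, class lead; file 84 of the series)

HONEST FRAMING (cell `b2b-bsdres`, run/shared/lean/b2b/bsd-rank1-residual/, verbatim in every
file): the goal of the cell is to DELETE the COMBINATION-SHAPED residual classes of the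
Birch–Swinnerton-Dyer formula for ALL analytic-rank `≤ 1` elliptic curves over `ℚ` — "full BSD
formula for every rank `≤ 1` curve in class `C`" assembled STRICTLY from published theorems — so
that the rank-`≤ 1` remainder becomes exactly the CONSTRUCTION-SHAPED classes, which are TYPED
(missing-input `Prop`s), NOT attempted. This is not "finishing BSD". CLASS-CLOSURE lane: prove
what is provable now; shrink each hard class to its core with data; no claim beyond stated classes;
research routes on CONSTRUCTION-SHAPED X12 / O10; census / instrument output = EVIDENCE / conjecture
items, NEVER a Literature fact; `RESIDUAL-MAP.md` marks change only by signed lines. THIS FILE: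
TOOL THEOREMS ONLY — no definition, no named Literature fact, no `sorry`, axioms standard; nothing
is booked; no label / mark / count / sub-cell moves; (C1_η), (C2_η-GZ), (C3_η) stay typed as filed
(cc-typer-6's pen); nothing about `BSD(W, p)` of any pair is claimed.

## Why (x1b GEN 39 note `B3-CORANK-ENGINE-x1b.md` §3 (iv))

File 74 proved the bridge with the MINIMAL local group `L = loc_{v₀}(Ψ_m⁻¹A₀)` at `v₀`, and file 77
composed it with the finite-level count under `hC : 𝓣_{v₀} ⊓ L = p^t·C`, `C ⊔ 𝓚 = ⊤`, `t ≤ m − ν`.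
Those hypotheses silently imply the GLOBAL bound `#L ≥ p^ν` — half of the conclusion — so they
cannot be discharged locally. The fix is to run the count with `𝓖_{v₀} = 𝓣_{v₀} ⊓ G` for a LARGER
local group `G` (the receptacle: `G = p^{ν+e}·Σ_m`, `Σ_m` the level-`m` minus condition), which
requires the bridge for an arbitrary `G` between `L` and the classes detecting the signed condition.
That is this file; nothing else changes.

## What

* `mem_selmerGroup_update_iff_levelToLayerZero_mem_of_receptacle`: for a tower structure `𝓣` at
  level `m`, ANY `A ≤ E(Ē)` and ANY `G ≤ H¹(K_{v₀}, E[p^m])` such that (a) `Ψ_m c ∈ A₀ ⟹ loc_{v₀} c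
  ∈ G` and (b) `Ψ_m c ∈ h_0⁻¹(Sel_∞)`, `loc_{v₀} c ∈ G ⟹ Ψ_m c` is signed at `E`:
  **`c ∈ H¹_{𝓣[v₀ ↦ 𝓣_{v₀} ⊓ G]} ↔ Ψ_m c ∈ A₀`** (file 72's one-place refinement; NO model maps
  `E ⇄ K_{v₀}` are needed — the locality is carried by (a)/(b));
* **`relIndex_selmerGroup_update_eq_relIndex_strictSignedSelmerLayer_of_receptacle`**: hence
  `[H¹_{𝓣[v₀ ↦ 𝓣_{v₀} ⊓ G]} : H¹_{𝓚[v₀ ↦ 0]}] = [A₀ : S₀]` for `A₀ = Sel^{loc,∞}` on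
  `A = ⨆_n E^{−,str}(K_n·E)`, `S₀ = Sel^{−,str}(E/K_0)` (the `S₀` side is file 74 §1 and does use the
  model `E ⇄ K_{v₀}` and `E(Ē)[p^∞]^{Γ_E} = 0`), once `p^m A₀ = 0` and `E(K̄)` is divisible.
For `G = L` hypotheses (a)/(b) are file 74's; for `G ⊆ Σ_m` (b) is "a class restricting into the
minus Kummer condition at a finite layer is signed" and (a) is `L ≤ G`, i.e. `#L ≤ #G` inside the
cyclic `Σ_m` (x1b GEN 39 files 79–83 and note §3).

References: [GreenbergLNM1716] §3 pp. 85–90; [Kobayashi2003] Def. 2.1 (p. 5), §9 Thm. 9.3 (p. 26).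
-/

noncomputable section

open scoped Classical

open WeierstrassCurve Literature.NumberTheory.EllipticCurves Literature.NumberTheory.GaloisRepresentations
  NumberField IsDedekindDomain Field
open Literature.NumberTheory.GaloisRepresentations.DiscreteGaloisModule (SelmerStructure)
open Literature.NumberTheory.EllipticCurves.Kobayashi2003
open Summit.BirchSwinnertonDyer.Rank1Residual.X11b.Levels
open Summit.BirchSwinnertonDyer.Rank1Residual.X11b
open scoped ContRepresentation

namespace Summit.BirchSwinnertonDyer.Rank1Residual.Additive.LevelBridge

universe u

section Loc

variable {K : Type u} [Field K] [NumberField K] (W : WeierstrassCurve K) (p : ℕ)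
  [hp : Fact p.Prime] (κ : ZpExtension K p) (m : ℕ) (v₀ : HeightOneSpectrum (𝓞 K))
  (E : Type u) [Field E] [Algebra K E]

/-- **`Ψ_m c ∈ A₀ ↔ c ∈ H¹_{𝓣[v₀ ↦ 𝓣_{v₀} ⊓ G]}` for ANY local receptacle `G`** between
`L = loc_{v₀}(Ψ_m⁻¹A₀)` and the classes that detect the signed part: if (a) every class with
`Ψ_m c ∈ A₀` has `loc_{v₀} c ∈ G` (`L ≤ G`) and (b) every class with `Ψ_m c ∈ h_0⁻¹(Sel_∞)` and
`loc_{v₀} c ∈ G` has `Ψ_m c` signed at `E`, then `A₀` is (along `Ψ_m`) the Selmer group of the tower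
structure refined at `v₀` by `G` — the receptacle-agnostic form of file 74 §2 (there `G = L`).
[cite: GreenbergLNM1716, §3 pp. 85–86] [cite: Kobayashi2003, Def. 2.1 (p. 5) and §9] -/
theorem mem_selmerGroup_update_iff_levelToLayerZero_mem_of_receptacle
    (𝓣 : SelmerStructure (W.torsionGaloisModule ((p ^ m : ℕ) : ℤ)))
    (h𝓣fin : ∀ v : HeightOneSpectrum (𝓞 K), 𝓣 (Sum.inr v) =
      (W.localTowerKer κ (v.adicCompletion K) 0).comap
        ((resH1Hom (subgroupIncl (localSubgroup (κ.layerSubgroup 0) (v.adicCompletion K)))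
          (AddMonoidHom.id (localPoints W (v.adicCompletion K))) (fun _ _ ↦ rfl)).comp
          (galoisCohomology.map
            (W.torsionPointsMapIntertwining ((p ^ m : ℕ) : ℤ) (v.adicCompletion K)) 1)))
    (h𝓣inf : ∀ w : InfinitePlace K, 𝓣 (Sum.inl w) = W.kummerSelmerStructure ((p ^ m : ℕ) : ℤ) (Sum.inl w))
    (A : AddSubgroup (localPoints W E))
    (G : AddSubgroup (galoisCohomology ((W.torsionGaloisModule ((p ^ m : ℕ) : ℤ)).toLocal (Sum.inr v₀)) 1))
    (hLG : ∀ c : galoisCohomology (W.torsionGaloisModule ((p ^ m : ℕ) : ℤ)) 1,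
      resH1Hom (subgroupIncl (κ.layerSubgroup 0)) (AddMonoidHom.id (geomPrimaryTorsion W p))
        (fun _ _ ↦ rfl) (galoisCohomology.map (primaryInclusion W p m) 1 c) ∈
        (W.selmerInfty κ ⊓ ⨅ σ : absoluteGaloisGroup K,
            (localKummerOverOfEmb W p κ.kerSubgroup (closureEmb (K := K) E) A).comap
              (W.conjH1 p κ.kerSubgroup σ)).comap (W.layerToInfty κ 0) →
      galoisCohomology.localization (W.torsionGaloisModule ((p ^ m : ℕ) : ℤ)) (Sum.inr v₀) 1 c ∈ G)
    (hG : ∀ c : galoisCohomology (W.torsionGaloisModule ((p ^ m : ℕ) : ℤ)) 1,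
      resH1Hom (subgroupIncl (κ.layerSubgroup 0)) (AddMonoidHom.id (geomPrimaryTorsion W p))
        (fun _ _ ↦ rfl) (galoisCohomology.map (primaryInclusion W p m) 1 c) ∈ W.selmerInftyPreimage κ 0 →
      galoisCohomology.localization (W.torsionGaloisModule ((p ^ m : ℕ) : ℤ)) (Sum.inr v₀) 1 c ∈ G →
      resH1Hom (subgroupIncl (κ.layerSubgroup 0)) (AddMonoidHom.id (geomPrimaryTorsion W p))
        (fun _ _ ↦ rfl) (galoisCohomology.map (primaryInclusion W p m) 1 c) ∈
        (⨅ σ : absoluteGaloisGroup K,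
            (localKummerOverOfEmb W p κ.kerSubgroup (closureEmb (K := K) E) A).comap
              (W.conjH1 p κ.kerSubgroup σ)).comap (W.layerToInfty κ 0))
    (c : galoisCohomology (W.torsionGaloisModule ((p ^ m : ℕ) : ℤ)) 1) :
    c ∈ SelmerStructure.selmerGroup (Function.update 𝓣 (Sum.inr v₀) (𝓣 (Sum.inr v₀) ⊓ G)) ↔
      resH1Hom (subgroupIncl (κ.layerSubgroup 0)) (AddMonoidHom.id (geomPrimaryTorsion W p))
        (fun _ _ ↦ rfl) (galoisCohomology.map (primaryInclusion W p m) 1 c) ∈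
        (W.selmerInfty κ ⊓ ⨅ σ : absoluteGaloisGroup K,
            (localKummerOverOfEmb W p κ.kerSubgroup (closureEmb (K := K) E) A).comap
              (W.conjH1 p κ.kerSubgroup σ)).comap (W.layerToInfty κ 0) := by
  rw [AddSubgroup.comap_inf]
  refine mem_selmerGroup_update_inf_iff_levelToLayerZero_mem_inf W p κ m 𝓣 (W.selmerInftyPreimage κ 0)
    (mem_selmerGroup_iff_levelToLayerZero_mem_selmerInftyPreimage W p κ m 𝓣 h𝓣fin h𝓣inf)
    (Sum.inr v₀) _ _ (fun c hc ↦ ⟨fun hloc ↦ hG c hc hloc, fun hS ↦ hLG c ?_⟩) c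
  rw [AddSubgroup.comap_inf]
  exact AddSubgroup.mem_inf.mpr ⟨hc, hS⟩

end Loc

section Index

variable {K : Type u} [Field K] [NumberField K] (W : WeierstrassCurve K) [W.IsElliptic] (p : ℕ)
  [hp : Fact p.Prime] (κ : ZpExtension K p) (m : ℕ) (v₀ : HeightOneSpectrum (𝓞 K))
  (E : Type u) [Field E] [Algebra K E] [Algebra (v₀.adicCompletion K) E]
  [IsScalarTower K (v₀.adicCompletion K) E] [Algebra E (v₀.adicCompletion K)]
  [IsScalarTower K E (v₀.adicCompletion K)]

/-- **THE BRIDGE with a receptacle: `[H¹_{𝓣[v₀ ↦ 𝓣_{v₀} ⊓ G]} : H¹_{𝓚[v₀ ↦ 0]}] = [A₀ : S₀]`** for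
ANY `G ≤ H¹(K_{v₀}, E[p^m])` containing the localisations of `Ψ_m⁻¹A₀` and detecting the signed
condition (`hLG`, `hG` as above), `A₀ = Sel^{loc,∞}` built on `A = ⨆_n E^{−,str}(K_n·E)`,
`S₀ = Sel^{−,str}(E/K_0)`. With `G = p^{ν+e}·Σ_m` (`Σ_m` the level-`m` minus condition, a cyclic
complement of `𝓚_{v₀}`) this is the input shape of the count (C) at finite level (files 63/68/69)
WITHOUT the constraint hidden in file 77's literal `hC` (x1b GEN 39 note §3 (iv)).
[cite: GreenbergLNM1716, §3 pp. 85–90] [cite: Kobayashi2003, Def. 2.1 (p. 5), §9 Thm. 9.3 (p. 26)] -/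
theorem relIndex_selmerGroup_update_eq_relIndex_strictSignedSelmerLayer_of_receptacle
    (hdiv : W.zsmul_geomPoints_surjective)
    (hΓE : ∀ Q : W.geomPrimaryTorsion p, (∀ σ : absoluteGaloisGroup E,
      GaloisRep.restrictField E (LocBridge.primaryGaloisModule W p) σ Q = Q) → Q = 0)
    (𝓣 : SelmerStructure (W.torsionGaloisModule ((p ^ m : ℕ) : ℤ)))
    (h𝓣fin : ∀ v : HeightOneSpectrum (𝓞 K), 𝓣 (Sum.inr v) =
      (W.localTowerKer κ (v.adicCompletion K) 0).comap
        ((resH1Hom (subgroupIncl (localSubgroup (κ.layerSubgroup 0) (v.adicCompletion K)))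
          (AddMonoidHom.id (localPoints W (v.adicCompletion K))) (fun _ _ ↦ rfl)).comp
          (galoisCohomology.map
            (W.torsionPointsMapIntertwining ((p ^ m : ℕ) : ℤ) (v.adicCompletion K)) 1)))
    (h𝓣inf : ∀ w : InfinitePlace K, 𝓣 (Sum.inl w) = W.kummerSelmerStructure ((p ^ m : ℕ) : ℤ) (Sum.inl w))
    (hA₀ : ∀ z ∈ (W.selmerInfty κ ⊓ ⨅ σ : absoluteGaloisGroup K,
        (localKummerOverOfEmb W p κ.kerSubgroup (closureEmb (K := K) E)
          (⨆ n, strictSignedLocalPoints κ E W (-1) n)).comap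
            (W.conjH1 p κ.kerSubgroup σ)).comap (W.layerToInfty κ 0), p ^ m • z = 0)
    (G : AddSubgroup (galoisCohomology ((W.torsionGaloisModule ((p ^ m : ℕ) : ℤ)).toLocal (Sum.inr v₀)) 1))
    (hLG : ∀ c : galoisCohomology (W.torsionGaloisModule ((p ^ m : ℕ) : ℤ)) 1,
      resH1Hom (subgroupIncl (κ.layerSubgroup 0)) (AddMonoidHom.id (geomPrimaryTorsion W p))
        (fun _ _ ↦ rfl) (galoisCohomology.map (primaryInclusion W p m) 1 c) ∈
        (W.selmerInfty κ ⊓ ⨅ σ : absoluteGaloisGroup K,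
            (localKummerOverOfEmb W p κ.kerSubgroup (closureEmb (K := K) E)
              (⨆ n, strictSignedLocalPoints κ E W (-1) n)).comap
              (W.conjH1 p κ.kerSubgroup σ)).comap (W.layerToInfty κ 0) →
      galoisCohomology.localization (W.torsionGaloisModule ((p ^ m : ℕ) : ℤ)) (Sum.inr v₀) 1 c ∈ G)
    (hG : ∀ c : galoisCohomology (W.torsionGaloisModule ((p ^ m : ℕ) : ℤ)) 1,
      resH1Hom (subgroupIncl (κ.layerSubgroup 0)) (AddMonoidHom.id (geomPrimaryTorsion W p))
        (fun _ _ ↦ rfl) (galoisCohomology.map (primaryInclusion W p m) 1 c) ∈ W.selmerInftyPreimage κ 0 →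
      galoisCohomology.localization (W.torsionGaloisModule ((p ^ m : ℕ) : ℤ)) (Sum.inr v₀) 1 c ∈ G →
      resH1Hom (subgroupIncl (κ.layerSubgroup 0)) (AddMonoidHom.id (geomPrimaryTorsion W p))
        (fun _ _ ↦ rfl) (galoisCohomology.map (primaryInclusion W p m) 1 c) ∈
        (⨅ σ : absoluteGaloisGroup K,
            (localKummerOverOfEmb W p κ.kerSubgroup (closureEmb (K := K) E)
              (⨆ n, strictSignedLocalPoints κ E W (-1) n)).comap
              (W.conjH1 p κ.kerSubgroup σ)).comap (W.layerToInfty κ 0)) :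
    (SelmerStructure.selmerGroup
        (Function.update (W.kummerSelmerStructure ((p ^ m : ℕ) : ℤ)) (Sum.inr v₀) ⊥)).relIndex
      (SelmerStructure.selmerGroup (Function.update 𝓣 (Sum.inr v₀) (𝓣 (Sum.inr v₀) ⊓ G))) =
      (strictSignedSelmerLayer W κ E (-1) 0).relIndex
        ((W.selmerInfty κ ⊓ ⨅ σ : absoluteGaloisGroup K,
          (localKummerOverOfEmb W p κ.kerSubgroup (closureEmb (K := K) E)
            (⨆ n, strictSignedLocalPoints κ E W (-1) n)).comap
              (W.conjH1 p κ.kerSubgroup σ)).comap (W.layerToInfty κ 0)) :=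
  relIndex_selmerGroup_eq_of_iff W p κ m hdiv _ _ _ _ hA₀
    (fun c ↦ mem_selmerGroup_update_bot_iff_levelToLayerZero_mem_strictSignedSelmerLayer W p κ m v₀ E
      hΓE c)
    (fun c ↦ mem_selmerGroup_update_iff_levelToLayerZero_mem_of_receptacle W p κ m v₀ E 𝓣 h𝓣fin
      h𝓣inf _ G hLG hG c)

end Index

end Summit.BirchSwinnertonDyer.Rank1Residual.Additive.LevelBridge

end
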